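import Summits.BirchSwinnertonDyer.BirchSwinnertonDyer.Theorems.PrintCf2SplitBadTwoLineDoubleCosetFrame
import Summits.BirchSwinnertonDyer.BirchSwinnertonDyer.Theorems.PrintCf2SplitBadTwoUnrLocalLift
import Summits.BirchSwinnertonDyer.BirchSwinnertonDyer.Theorems.PrintCf2SplitBadTwoStrictDatumOfUnrDatum
import Summits.BirchSwinnertonDyer.BirchSwinnertonDyer.Theorems.EisensteinPrimesUnramifiedKerReps
import Literature.NumberTheory.EllipticCurves.H1CorestrictionIndexTwo
import HarnessLib

/-!
# Crux `PrintCf2.SplitBadTwoRankOneOfFacts` (stmt-BirchSwinnertonDyer-20368), road α v13, stub S3d — the σ-BOOKKEEPING brick (DC), part 3: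
# `Q = S_{W*}(K*_∞) ⧸ 𝔖` EMBEDS Γ-EQUIVARIANTLY IN THE LOCAL DEFECT GROUP, in X11b `Coinv.kerD` currency (where local conjugation exists)

Cell `bsd-print-cf2`, EXTRA WIDTH seat `bsd-line-cf2-p1-w8` g4 (prover-bsd-line-cf2-p1-w8-g4-0); LEAD ASSIGN 2026-08-29T02:30:44Z («(DC): … the primes
above `v̄` as an index set WITH Γ*-ACTION»); `--supports stmt-BirchSwinnertonDyer-20368` (helper, Theses-free). Sequel of parts 1–2
(`PrintCf2SplitBadTwoLineDoubleCoset`, `…Frame`). HONEST FRAMING: nothing here closes the crux or a registered stub; BSD is not proved by any of this;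
no summit `Statement.lean` is touched; no `sorry`, no new axiom, no Literature fact, no definition.

## What and why

-w3 g11's class-(iii) reader `StrictDefect.hasCharValuationAt_restricted_of_unr_of_injective_of_not_finite` takes an abelian group `H` with an
endomorphism `ψH`, an INJECTIVE `j : Q →+ H` (`Q := ↥(unrSelmer κ M 𝔮 ∅) ⧸ 𝔖.addSubgroupOf _`) and the EQUIVARIANCE
`hje : j (ψ_Q q) = ψH (j q)` for `ψ_Q` induced by `conjUnr γ − 1`. Part 2 gave `(j, hj)` in -w6 g4's `resOfLe` currency, where no local conjugation is
available. Here the same embedding is built in X11b's currency `Coinv.kerD κ 𝔮 ⊴ ↥D_𝔮` — `resKerD : H¹(ker κ, M) → H¹(kerD, M)`, with the LOCAL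
CONJUGATION `conjH1 (Coinv.kerD κ 𝔮) M d` (`d ∈ D_𝔮`) and its naturality `Coinv.resKerD_conjH1` — and the equivariance is PROVED: since the line is
totally ramified at `𝔮` (part 2: `κ(I_𝔮) = ℤ_p` on road α), `γ = τ·h` with `τ ∈ I_𝔮`, `h ∈ ker κ`, so `conj_γ = conj_τ` on `H¹(ker κ, M)` and
`resKerD ∘ conj_γ = conj_τ^{loc} ∘ resKerD`. With `𝓛 := ker ρ` (-w4 g11's unramified local classes, `ρ` = restriction along `Coinv.toKerD` to
`↥(ker κ ⊓ I_𝔮)`), the outputs are exactly `(H := ↥𝓛, ψH := conj_τ^{loc} − 1, j, hj, hje)`; the remaining inputs of the reader (`hH`: `𝓛` cocyclic,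
and the counts `#𝓛^{ψH}`, `𝓛_{ψH}`) are -w6 g5's / -w4 g11's local lane («`𝓛 ≅ W*`»).

* §1 generic (`K`, `p`, `κ`, `M`, `𝔮`): `rho_resKerD_eq_zero_of_mem_unrSelmer` (`resKerD` of `S_nr` lands in `𝓛`), `conj_mem_inertia`,
  `rho_conjH1_kerD_eq_zero` (`𝓛` is `conj_d^{loc}`-stable, `d ∈ D_𝔮`), `resKerD_conjH1_eq_of_eq_mul` (`γ = τ·h` ⟹ `resKerD (conj_γ c) = conj_τ^{loc}(resKerD c)`),
  `mem_restrictedSelmerZp_iff_resKerD_eq_zero` and **`exists_equivariant_injective_toLocalDefectKerD`** (totally ramified line, `K` totally complex,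
  `awayKer = unramifiedKer` away from `p`).
* §2 road α: `kerD_inputs_of_frame` — the two frame inputs (unit value of `κ′` on `I_v̄`, part 2; `awayKer = unramifiedKer` away from `2`, -w6 g4) packaged, so the assembler instantiates §1 in its own generic-`V` typing (a concrete-`W.baseChange K` restatement of the kerD embedding exceeds the elaboration heartbeat budget and is deliberately NOT made).

[cite: GreenbergVatsal2000, §2 pp. 17, 20–21 (Cor. 2.3: `S^{Σ₀}/S ≅ ∏ 𝓗_ℓ`)] [cite: Agboola2007, §3 Prop. 3.2] [cite: SerreGaloisCohomology1997, I §2.5]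
[cite: NeukirchANT1999, Ch. I §9] [cite: JetchevSkinnerWan2017, Lemma 3.3.3 (arXiv:1512.06894 p. 12)]
-/

noncomputable section

set_option linter.dupNamespace false
set_option autoImplicit false

open scoped Classical

open NumberField IsDedekindDomain Field
open Literature.NumberTheory.EllipticCurves Literature.NumberTheory.EllipticCurves.GreenbergSelmer
open Literature.NumberTheory.EllipticCurves.Agboola2007 Literature.NumberTheory.EllipticCurves.GreenbergVatsal2000
open Literature.NumberTheory.EllipticCurves.KellerYin2024
open Literature.NumberTheory.GaloisRepresentations
open Summit.BirchSwinnertonDyer.Rank1Residual.X11b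
open Summit.BirchSwinnertonDyer.BirchSwinnertonDyer.Theorems.AnomalousLocalTorsion
open Summit.BirchSwinnertonDyer.BirchSwinnertonDyer.Theorems.UnramifiedKerReps (conj_mem_inertia_of_mem_decomp)
open Summit.BirchSwinnertonDyer.BirchSwinnertonDyer.Theorems.PrintCf2.UnrBaseLift (kerSubgroup_inf_inertia_le_decomp toKerD_comp_resKerD
  resOfLe_inertia_eq_zero_of_mem_unrSelmer)
open Summit.BirchSwinnertonDyer.BirchSwinnertonDyer.Theorems.PrintCf2.StrictDefect (addSubgroupOf_le_comap_conjUnr_sub_one)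

universe u

namespace Summit.BirchSwinnertonDyer.BirchSwinnertonDyer.Theorems.PrintCf2.LineDoubleCoset

/-! ## §1. Generic: `𝓛`, its stability under local conjugation, and the equivariant embedding for a totally ramified line -/

section Generic

variable {K : Type} [Field K] [NumberField K] {p : ℕ} [Fact p.Prime] (κ : ZpExtension K p)
  (M : Type) [AddCommGroup M] [DistribMulAction (absoluteGaloisGroup K) M] [TopologicalSpace M] [DiscreteTopology M]
  (𝔮 : HeightOneSpectrum (𝓞 K))

/-- **`resKerD` of an `S_nr`-class is an UNRAMIFIED local class**: it dies under the restriction `ρ` along `Coinv.toKerD` to `ker κ ⊓ I_𝔮`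
(-w4 g11's `toKerD_comp_resKerD` + `resOfLe_inertia_eq_zero_of_mem_unrSelmer`). [cite: GreenbergVatsal2000, §2 pp. 16–17] -/
theorem rho_resKerD_eq_zero_of_mem_unrSelmer (h𝔮 : ((p : ℕ) : 𝓞 K) ∈ 𝔮.asIdeal) {c : subgroupH1 κ.kerSubgroup M}
    (hc : c ∈ unrSelmer κ M 𝔮 ∅) :
    resH1Hom (Coinv.toKerD κ 𝔮 (kerSubgroup_inf_inertia_le_decomp κ 𝔮) (inf_le_left : κ.kerSubgroup ⊓ inertia 𝔮 ≤ κ.kerSubgroup))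
      (AddMonoidHom.id M) (fun _ _ ↦ rfl) (Coinv.resKerD κ M 𝔮 c) = 0 := by
  rw [← AddMonoidHom.comp_apply, toKerD_comp_resKerD]
  exact resOfLe_inertia_eq_zero_of_mem_unrSelmer h𝔮 hc

/-- `I_𝔮 ⊴ D_𝔮`: `d⁻¹ i d ∈ I_𝔮` for `d ∈ D_𝔮`, `i ∈ I_𝔮` (bsd-eis `UnramifiedKerReps.conj_mem_inertia_of_mem_decomp`). [cite: NeukirchANT1999, Ch. I §9 (9.5)] -/
theorem conj_mem_kerSubgroup_inf_inertia (κ : ZpExtension K p) {d x : absoluteGaloisGroup K} (hd : d ∈ decomp 𝔮)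
    (hx : x ∈ κ.kerSubgroup ⊓ inertia 𝔮) : d⁻¹ * x * d ∈ κ.kerSubgroup ⊓ inertia 𝔮 :=
  Subgroup.mem_inf.mpr ⟨conj_mem_of_normal κ.kerSubgroup d ⟨x, (Subgroup.mem_inf.mp hx).1⟩,
    conj_mem_inertia_of_mem_decomp 𝔮 hd (Subgroup.mem_inf.mp hx).2⟩

/-- **`𝓛 = ker ρ` is stable under the local conjugation `conj_d^{loc}`, `d ∈ D_𝔮`**: on a cocycle `z` of `kerD` with `z = ∂a` on `ker κ ⊓ I_𝔮`,
`d • z(d⁻¹ x d) = ∂(d a)(x)` there (`d⁻¹ x d ∈ ker κ ⊓ I_𝔮`). [cite: SerreGaloisCohomology1997, I §2.5] -/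
theorem rho_conjH1_kerD_eq_zero (d : decomp (K := K) 𝔮) (ℓ : subgroupH1 (Coinv.kerD κ 𝔮) M)
    (hℓ : resH1Hom (Coinv.toKerD κ 𝔮 (kerSubgroup_inf_inertia_le_decomp κ 𝔮) (inf_le_left : κ.kerSubgroup ⊓ inertia 𝔮 ≤ κ.kerSubgroup))
      (AddMonoidHom.id M) (fun _ _ ↦ rfl) ℓ = 0) :
    resH1Hom (Coinv.toKerD κ 𝔮 (kerSubgroup_inf_inertia_le_decomp κ 𝔮) (inf_le_left : κ.kerSubgroup ⊓ inertia 𝔮 ≤ κ.kerSubgroup))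
      (AddMonoidHom.id M) (fun _ _ ↦ rfl) (conjH1 (Coinv.kerD κ 𝔮) M d ℓ) = 0 := by
  obtain ⟨z, rfl⟩ := oneCocycleClass_surjective _ ℓ
  rw [conjH1_oneCocycleClass]
  rw [CocycleCriteria.resH1Hom_oneCocycleClass_eq_zero_iff] at hℓ ⊢
  obtain ⟨a, ha⟩ := hℓ
  refine ⟨((d : decomp (K := K) 𝔮) : absoluteGaloisGroup K) • a, fun x ↦ ?_⟩
  have hx' : ((d : decomp (K := K) 𝔮) : absoluteGaloisGroup K)⁻¹ * (x : absoluteGaloisGroup K) * d ∈ κ.kerSubgroup ⊓ inertia 𝔮 :=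
    conj_mem_kerSubgroup_inf_inertia 𝔮 κ d.2 x.2
  have heq : subgroupConj (Coinv.kerD κ 𝔮) d
      (Coinv.toKerD κ 𝔮 (kerSubgroup_inf_inertia_le_decomp κ 𝔮) (inf_le_left : κ.kerSubgroup ⊓ inertia 𝔮 ≤ κ.kerSubgroup) x) =
      Coinv.toKerD κ 𝔮 (kerSubgroup_inf_inertia_le_decomp κ 𝔮) (inf_le_left : κ.kerSubgroup ⊓ inertia 𝔮 ≤ κ.kerSubgroup) ⟨_, hx'⟩ := by
    apply Subtype.ext
    apply Subtype.ext
    rw [subgroupConj_apply_coe, Subgroup.coe_mul, Subgroup.coe_mul, Subgroup.coe_inv]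
    rfl
  have ha' := ha ⟨_, hx'⟩
  rw [AddMonoidHom.id_apply] at ha' ⊢
  rw [conjCocycle_apply, heq, ha']
  change ((d : decomp (K := K) 𝔮) : absoluteGaloisGroup K) •
      ((((d : decomp (K := K) 𝔮) : absoluteGaloisGroup K)⁻¹ * (x : absoluteGaloisGroup K) * d) • a - a) =
    (x : absoluteGaloisGroup K) • (((d : decomp (K := K) 𝔮) : absoluteGaloisGroup K) • a) - ((d : decomp (K := K) 𝔮) : absoluteGaloisGroup K) • a
  rw [smul_sub, smul_smul, smul_smul, ← mul_assoc, ← mul_assoc, mul_inv_cancel, one_mul]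

/-- **`resKerD ∘ conj_γ = conj_τ^{loc} ∘ resKerD` when `γ = τ · h` with `τ ∈ D_𝔮`, `h ∈ ker κ`** (inner automorphisms act trivially on classes,
`conjH1_of_mem_holds`; naturality `Coinv.resKerD_conjH1`). [cite: SerreGaloisCohomology1997, I §2.5] [cite: SerreLocalFields1979, VII §5 Prop. 3] -/
theorem resKerD_conjH1_eq_of_eq_mul (κ : ZpExtension K p) {γ h : absoluteGaloisGroup K} (τ : decomp (K := K) 𝔮) (hh : h ∈ κ.kerSubgroup)
    (hγ : γ = (τ : absoluteGaloisGroup K) * h) (c : subgroupH1 κ.kerSubgroup M) :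
    Coinv.resKerD κ M 𝔮 (conjH1 κ.kerSubgroup M γ c) = conjH1 (Coinv.kerD κ 𝔮) M τ (Coinv.resKerD κ M 𝔮 c) := by
  rw [hγ, conjH1_mul_holds κ.kerSubgroup M, AddMonoidHom.comp_apply, conjH1_of_mem_holds κ.kerSubgroup M hh, AddMonoidHom.id_apply,
    Coinv.resKerD_conjH1]

/-- **Agboola's strictness in `resKerD` currency** (totally ramified line, `K` totally complex, `awayKer = unramifiedKer` away from `p`): for
`c ∈ S_nr`, `c ∈ 𝔖 ↔ resKerD c = 0` (part 2's `mem_restrictedSelmerZp_iff_resOfLe_eq_zero` + `Coinv.mem_awayKer_iff_resKerD_eq_zero`).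
[cite: Agboola2007, §3 (arXiv p0008:L58–80)] [cite: Greenberg1989, §1 p. 98 (3)] -/
theorem mem_restrictedSelmerZp_iff_resKerD_eq_zero [IsTotallyComplex K]
    (haway : ∀ w : HeightOneSpectrum (𝓞 K), ((p : ℕ) : 𝓞 K) ∉ w.asIdeal →
      GreenbergSelmer.awayKer κ.kerSubgroup M w = GreenbergVatsal2000.unramifiedKer κ.kerSubgroup M w)
    {τ₁ : absoluteGaloisGroup K} (hτ₁ : τ₁ ∈ GreenbergSelmer.inertia 𝔮) (hu : IsUnit (κ τ₁).toAdd)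
    {c : subgroupH1 κ.kerSubgroup M} (hc : c ∈ unrSelmer κ M 𝔮 ∅) :
    c ∈ restrictedSelmerZp κ M 𝔮 ↔ Coinv.resKerD κ M 𝔮 c = 0 := by
  rw [mem_restrictedSelmerZp_iff_resOfLe_eq_zero κ M haway hτ₁ hu hc, ← Coinv.mem_awayKer_iff_resKerD_eq_zero, GreenbergSelmer.awayKer,
    AddMonoidHom.mem_ker]

/-- **(DC-6, generic) THE Γ-EQUIVARIANT EMBEDDING `Q ↪ 𝓛` for a totally ramified line.** `K` totally complex, `κ` a `ℤ_p`-line with a unit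
value on `I_𝔮` (`κ(I_𝔮) = ℤ_p`), `awayKer = unramifiedKer` away from `p`, and ANY `γ ∈ Γ_K`. Then there are `τ ∈ D_𝔮` lying in `I_𝔮` with
`κ τ = κ γ` and an INJECTIVE additive `j : Q →+ ↥𝓛` (`Q := S_nr ⧸ 𝔖`, `𝓛 := ker ρ` the unramified local classes in `H¹(kerD, M)`) with
`j [c] = resKerD c` and `j ((conj_γ − 1) q) = conj_τ^{loc} (j q) − j q`. [cite: GreenbergVatsal2000, §2 pp. 17, 20–21 (Cor. 2.3)]
[cite: Agboola2007, §3 Prop. 3.2] [cite: SerreGaloisCohomology1997, I §2.5] -/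
theorem exists_equivariant_injective_toLocalDefectKerD [IsTotallyComplex K] (h𝔮 : ((p : ℕ) : 𝓞 K) ∈ 𝔮.asIdeal)
    (haway : ∀ w : HeightOneSpectrum (𝓞 K), ((p : ℕ) : 𝓞 K) ∉ w.asIdeal →
      GreenbergSelmer.awayKer κ.kerSubgroup M w = GreenbergVatsal2000.unramifiedKer κ.kerSubgroup M w)
    {τ₁ : absoluteGaloisGroup K} (hτ₁ : τ₁ ∈ GreenbergSelmer.inertia 𝔮) (hu : IsUnit (κ τ₁).toAdd) (γ : absoluteGaloisGroup K) :
    ∃ (τ : decomp (K := K) 𝔮) (_ : (τ : absoluteGaloisGroup K) ∈ GreenbergSelmer.inertia 𝔮) (_ : κ τ = κ γ)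
      (j : (↥(unrSelmer κ M 𝔮 ∅) ⧸ (restrictedSelmerZp κ M 𝔮).addSubgroupOf (unrSelmer κ M 𝔮 ∅)) →+
        ↥(resH1Hom (Coinv.toKerD κ 𝔮 (kerSubgroup_inf_inertia_le_decomp κ 𝔮) (inf_le_left : κ.kerSubgroup ⊓ inertia 𝔮 ≤ κ.kerSubgroup))
          (AddMonoidHom.id M) (fun _ _ ↦ rfl)).ker),
      Function.Injective j ∧
      (∀ c : ↥(unrSelmer κ M 𝔮 ∅), ((j (QuotientAddGroup.mk c) : ↥(resH1Hom (Coinv.toKerD κ 𝔮 (kerSubgroup_inf_inertia_le_decomp κ 𝔮)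
          (inf_le_left : κ.kerSubgroup ⊓ inertia 𝔮 ≤ κ.kerSubgroup)) (AddMonoidHom.id M) (fun _ _ ↦ rfl)).ker) : subgroupH1 (Coinv.kerD κ 𝔮) M) =
        Coinv.resKerD κ M 𝔮 (c : subgroupH1 κ.kerSubgroup M)) ∧
      (∀ q, ((j (QuotientAddGroup.map _ _
            ((conjUnr κ M 𝔮 ∅ γ - 1 : AddMonoid.End (unrSelmer κ M 𝔮 ∅)) : unrSelmer κ M 𝔮 ∅ →+ unrSelmer κ M 𝔮 ∅)
            (addSubgroupOf_le_comap_conjUnr_sub_one κ M 𝔮 γ) q) : ↥(resH1Hom (Coinv.toKerD κ 𝔮 (kerSubgroup_inf_inertia_le_decomp κ 𝔮)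
          (inf_le_left : κ.kerSubgroup ⊓ inertia 𝔮 ≤ κ.kerSubgroup)) (AddMonoidHom.id M) (fun _ _ ↦ rfl)).ker) : subgroupH1 (Coinv.kerD κ 𝔮) M) =
        conjH1 (Coinv.kerD κ 𝔮) M τ (j q : subgroupH1 (Coinv.kerD κ 𝔮) M) - (j q : subgroupH1 (Coinv.kerD κ 𝔮) M)) := by
  -- `γ = τ · h`, `τ ∈ I_𝔮`, `h ∈ ker κ`
  obtain ⟨τ, h, hτI, hh, hγ⟩ := exists_eq_inertia_mul_of_isUnit κ hτ₁ hu γ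
  have hτD : τ ∈ decomp 𝔮 := GreenbergSelmer.inertia_le_decomp 𝔮 hτI
  have hκτ : κ (⟨τ, hτD⟩ : decomp (K := K) 𝔮) = κ γ := by
    change κ τ = κ γ
    rw [hγ, map_mul, ZpExtension.mem_kerSubgroup.mp hh, mul_one]
  -- the map `c ↦ resKerD c` into `𝓛`
  have hmem : ∀ c : ↥(unrSelmer κ M 𝔮 ∅),
      Coinv.resKerD κ M 𝔮 (c : subgroupH1 κ.kerSubgroup M) ∈
        (resH1Hom (Coinv.toKerD κ 𝔮 (kerSubgroup_inf_inertia_le_decomp κ 𝔮) (inf_le_left : κ.kerSubgroup ⊓ inertia 𝔮 ≤ κ.kerSubgroup))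
          (AddMonoidHom.id M) (fun _ _ ↦ rfl)).ker :=
    fun c ↦ (AddMonoidHom.mem_ker).mpr (rho_resKerD_eq_zero_of_mem_unrSelmer κ M 𝔮 h𝔮 c.2)
  let f : ↥(unrSelmer κ M 𝔮 ∅) →+
      ↥(resH1Hom (Coinv.toKerD κ 𝔮 (kerSubgroup_inf_inertia_le_decomp κ 𝔮) (inf_le_left : κ.kerSubgroup ⊓ inertia 𝔮 ≤ κ.kerSubgroup))
          (AddMonoidHom.id M) (fun _ _ ↦ rfl)).ker :=
    { toFun := fun c ↦ ⟨Coinv.resKerD κ M 𝔮 (c : subgroupH1 κ.kerSubgroup M), hmem c⟩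
      map_zero' := Subtype.ext (by simp only [ZeroMemClass.coe_zero, map_zero])
      map_add' := fun a b ↦ Subtype.ext (by simp only [AddSubgroup.coe_add, map_add]) }
  have hf : ∀ c, ((f c : ↥(resH1Hom (Coinv.toKerD κ 𝔮 (kerSubgroup_inf_inertia_le_decomp κ 𝔮)
      (inf_le_left : κ.kerSubgroup ⊓ inertia 𝔮 ≤ κ.kerSubgroup)) (AddMonoidHom.id M) (fun _ _ ↦ rfl)).ker) : subgroupH1 (Coinv.kerD κ 𝔮) M) =
        Coinv.resKerD κ M 𝔮 (c : subgroupH1 κ.kerSubgroup M) := fun _ ↦ rfl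
  have hker : (restrictedSelmerZp κ M 𝔮).addSubgroupOf (unrSelmer κ M 𝔮 ∅) ≤ f.ker := by
    intro c hc
    rw [AddSubgroup.mem_addSubgroupOf] at hc
    rw [AddMonoidHom.mem_ker]
    exact Subtype.ext ((hf c).trans ((mem_restrictedSelmerZp_iff_resKerD_eq_zero κ M 𝔮 haway hτ₁ hu c.2).mp hc))
  refine ⟨⟨τ, hτD⟩, hτI, hκτ, QuotientAddGroup.lift _ f hker, fun a b hab ↦ ?_,
    fun c ↦ by rw [QuotientAddGroup.lift_mk _ hker]; exact hf c, fun q ↦ ?_⟩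
  · -- injectivity: equal restrictions differ by an element of `𝔖`
    obtain ⟨a, rfl⟩ := QuotientAddGroup.mk_surjective a
    obtain ⟨b, rfl⟩ := QuotientAddGroup.mk_surjective b
    rw [QuotientAddGroup.lift_mk _ hker, QuotientAddGroup.lift_mk _ hker] at hab
    rw [QuotientAddGroup.eq_iff_sub_mem, AddSubgroup.mem_addSubgroupOf]
    refine (mem_restrictedSelmerZp_iff_resKerD_eq_zero κ M 𝔮 haway hτ₁ hu (a - b).2).mpr ?_
    have h0 : Coinv.resKerD κ M 𝔮 (a : subgroupH1 κ.kerSubgroup M) = Coinv.resKerD κ M 𝔮 (b : subgroupH1 κ.kerSubgroup M) := by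
      have h1 := congrArg Subtype.val hab
      rwa [hf, hf] at h1
    rw [AddSubgroupClass.coe_sub, map_sub, sub_eq_zero]
    exact h0
  · -- equivariance: `resKerD ((conj_γ − 1) c) = conj_τ^{loc}(resKerD c) − resKerD c`
    obtain ⟨c, rfl⟩ := QuotientAddGroup.mk_surjective q
    rw [QuotientAddGroup.map_mk, QuotientAddGroup.lift_mk _ hker, QuotientAddGroup.lift_mk _ hker, hf, hf]
    change Coinv.resKerD κ M 𝔮 (((conjUnr κ M 𝔮 ∅ γ c - c : unrSelmer κ M 𝔮 ∅)) : subgroupH1 κ.kerSubgroup M) = _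
    rw [AddSubgroupClass.coe_sub, map_sub]
    change Coinv.resKerD κ M 𝔮 (conjH1 κ.kerSubgroup M γ (c : subgroupH1 κ.kerSubgroup M)) - _ = _
    rw [resKerD_conjH1_eq_of_eq_mul M 𝔮 κ ⟨τ, hτD⟩ hh hγ]

end Generic

/-! ## §2. Road α frames -/

section Frame

open WeierstrassCurve
open Summit.BirchSwinnertonDyer.BirchSwinnertonDyer.Theorems.PrintCf2.LineLocallyTrivial

variable {K : Type} [Field K] [NumberField K]

/-- **(DC-6) ON ROAD α — the frame inputs.** On every frame (member `C • W = cm7^{(d)}`, `K` imaginary quadratic, `2 = v v̄`, `π² = π − 2`,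
`W* = ↥((W.baseChange K).endEigenPrimaryTorsion 2 π r)`, `κ'` the line unramified outside `v̄`) the two hypotheses of the generic
`exists_equivariant_injective_toLocalDefectKerD` / `mem_restrictedSelmerZp_iff_resKerD_eq_zero` hold: a UNIT value of `κ'` on `I_v̄` (part 2,
`exists_mem_inertia_isUnit_of_frame`) and `awayKer = unramifiedKer` away from `2` (-w6 g4 `awayKer_eq_unramifiedKer_of_frame`). Packaged here as one
statement so that the assembler instantiates the generic theorem in ITS OWN (generic-`V`) typing — stating the kerD embedding at the concrete
`W.baseChange K` trips the elaborator's heartbeat budget (-w3 g10's kernel lesson), so no concrete-frame restatement is made.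
[cite: Washington1997, §13.1 Prop. 13.2] [cite: GreenbergVatsal2000, §2 p. 17] -/
theorem kerD_inputs_of_frame {d : ℤ} (hd0 : d ≠ 0) (W : WeierstrassCurve ℚ) [W.IsElliptic]
    (C : VariableChange ℚ) (hC : C • W = cm7.quadraticTwist (d : ℚ)) (hK : IsImaginaryQuadratic K)
    {v vbar : HeightOneSpectrum (𝓞 K)} (hv : ((2 : ℕ) : 𝓞 K) ∈ v.asIdeal) (hvbar : ((2 : ℕ) : 𝓞 K) ∈ vbar.asIdeal) (hne : vbar ≠ v)
    (π : (W.baseChange K).endRing) (hrel : (π : AddMonoid.End (W.baseChange K).geomPoints) * π = π - 2) (r : ℤ_[2])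
    (κ' : ZpExtension K 2) (hκ' : κ'.IsUnramifiedOutside vbar) :
    IsTotallyComplex K ∧
    (∃ τ₁ ∈ GreenbergSelmer.inertia vbar, IsUnit (κ' τ₁).toAdd) ∧
    (∀ w : HeightOneSpectrum (𝓞 K), ((2 : ℕ) : 𝓞 K) ∉ w.asIdeal →
      GreenbergSelmer.awayKer κ'.kerSubgroup ↥((W.baseChange K).endEigenPrimaryTorsion 2 π r) w =
        GreenbergVatsal2000.unramifiedKer κ'.kerSubgroup ↥((W.baseChange K).endEigenPrimaryTorsion 2 π r) w) :=
  ⟨hK.2, exists_mem_inertia_isUnit_of_frame hd0 W C hC hK hv hvbar hne π hrel κ' hκ',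
    fun _ hw ↦ awayKer_eq_unramifiedKer_of_frame W hK hv hvbar hne π r κ' hκ' hw⟩

end Frame

end Summit.BirchSwinnertonDyer.BirchSwinnertonDyer.Theorems.PrintCf2.LineDoubleCoset

end
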